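import Literature.MeasureTheory.Integral.SubmersionPushforwardDensity
import Mathlib.Analysis.Calculus.ImplicitContDiff
import Mathlib.Analysis.Calculus.FDeriv.Measurable
import Mathlib.MeasureTheory.Measure.Haar.Unique
import Mathlib.MeasureTheory.Measure.Lebesgue.EqHaar
import HarnessLib

/-!
# `FluctuationComparisonRegPrIntLS1aSubmersionDensityFibreAE` — THE PUSH-FORWARD OF A SHARP DENSITY UNDER A `C¹` SUBMERSION HAS A CONTINUOUS
# DENSITY NEAR A REGULAR POINT AS SOON AS ITS DISCONTINUITY SET MEETS EVERY FIBRE IN A NULL SET OF A PRESCRIBED FIBRE COORDINATE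
# (the local engine of S1aᴴ's window-continuity conjunct (c) at the anchor heights: `Literature/MeasureTheory/Integral/SubmersionPushforwardDensity`
# with a CHOSEN fibre projection `π` and an a.e.-on-the-fibre exemption, over `FibreCoordinates.continuousOn_density_of_fibreCoordinates_of_ae`)

Cell `ym3-torus` (HUMAN RULING D-0037: rung R3 = continuum SU(2) Yang–Mills on T³ — NOT d = 4, NOT infinite volume, NOT a mass gap, NOT Clay), WIDTH COPY «width 17»
of ym3-torus-p1, seat `ym3-torus-px17` gen 21; `--kind proof --supports stmt-QuantumFields-20520 --as helper` (count-neutral).  THEOREMS ONLY (no `def`, no `sorry`,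
no `instance`, no `notation`, default heartbeats).  FILE (F2) of the seat's 12:58Z INTENT.  Generic calculus ∕ measure theory on finite-dimensional real spaces; nothing
model-specific.

WHY.  The local engines of `Literature/MeasureTheory/Integral/` come in two continuity currencies: `SubmersionPushforward.exists_continuousOn_density_map_of_submersion`
(density CONTINUOUS on the chart neighbourhood) and `AnalyticSubmersion.…_sharp_fibreFlat` (density discontinuous across analytic thresholds that are POINTWISE not fibre-flat).
One UNCUT (0.4) step of [Balaban1987RG1] read on a guard cell carries the sharp indicator of the cell, and pointwise non-flatness of the guard spheres along the fibres at
LARGE fine fields is the open transversality (T⊥)♭ (UV3-NODE §67.7, §78; px13 g24 «guard-boundary (ii) open-ended»).  What the consumer CAN supply (file (F1)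
`…S1aSliceNullOfBiEquivariant`, by endpoint-gauge transitivity) is an a.e. statement in a PRESCRIBED fibre coordinate — the non-private bond variables: for every coarse
datum `y`, the non-private configurations over which the fibre point lies on a guard sphere form a null set.  THIS FILE is the local engine in exactly that currency: the
implicit-function chart is built with a GIVEN surjective linear `π : E → K` complementary to `ker DM(a)` (Mathlib `ImplicitFunctionData` with `rightFun := π`, so that the
fibre coordinate IS `π`), and the density `r` is asked to be continuous only off an exemption set `Z` whose fibre traces `{k | ∃ x ∈ O ∩ Z, M x = y, π x = k}` are `μK`-null
for every `y` in the coarse window; dominated convergence point by point (`FibreCoordinates.continuousOn_density_of_fibreCoordinates_of_ae`, p609518 v1.1) does the rest.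

CONTENT (namespace `Summit.QuantumFields.YangMills.Theorems.FluctuationComparisonRegPrIntLS1aSubmersionDensityFibreAE`).
* ★★★ `exists_continuousOn_density_map_of_submersion_fibreAE` — `E`, `Y`, `K` finite-dimensional real normed Borel spaces with additive Haar measures `μE`, `μY`, `μK`;
  `M : E → Y` measurable, `C¹` at `a`, `DM(a)` onto; `π : E →L[ℝ] K` onto with `IsCompl (ker DM(a)) (ker π)`.  THEN there are open `O ∋ a`, `D ∋ M a` such that for every
  exemption set `Z ⊆ E` with `μK {k | ∃ x, x ∈ O ∧ x ∈ Z ∧ M x = y ∧ π x = k} = 0` for all `y ∈ D`, and every `r : E → ℝ` measurable, `≥ 0`, bounded on `O`, zero off `O`,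
  and continuous at every `x ∈ O \ Z`: `∃ I ≥ 0`, `ContinuousOn I D`, `(r·μE)(M⁻¹ A) = ∫⁻_A I dμY` for every Borel `A ⊆ D`.
* ★ `exists_continuousOn_density_map_of_submersion_fibreAE'` — the same with the exemption phrased by a predicate `Q` («continuous at `x ∈ O` whenever `Q x`»; fibre traces of
  `{¬Q}` null), the shape of the local-face doors `Node00.RegSetOfLocalFaces.exists_continuous_density_SUN_of_flatLocalFaces`.

HONEST SCOPE.  (i) Local, near one regular point; `r` must vanish off `O`.  (ii) The VALUE of the density is chart bookkeeping (a Haar factor times a fibre integral); its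
existence and continuity are not.  (iii) Nothing of Bałaban's analysis is asserted or proved; the (0.4) cell maps, their full-guard submersion property (lit
✓`T4EMLFibreAC.kD_tangent_injective`) and the null fibre traces are the consumer's inputs (files (F3)–(F5) of the INTENT); S1aᴴ (c) at the anchor heights NOT closed by this
file; (m), (a), S1aᴴ, the five registered stubs, crux 20520 ∕ 19936 ∕ 19200 and `YM3TorusSU2` NOT proved; rung R3 = SU(2) YM₃ on T³ — NOT d = 4, NOT infinite volume,
NOT a mass gap, NOT Clay; the Yang–Mills mass gap is NOT proved by any of this.
References: [EvansGariepy1992] §3.4.2–§3.4.3 (C¹-submersion co-area, fibred special case); [Balaban1987RG1] CMP 109 (1987) (2.1)–(2.10) pp. 265–267 (measure-level reading).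
-/

set_option autoImplicit false

noncomputable section

namespace Summit.QuantumFields.YangMills.Theorems.FluctuationComparisonRegPrIntLS1aSubmersionDensityFibreAE

open MeasureTheory MeasureTheory.Measure Set Function Filter Metric
open scoped ENNReal NNReal Topology
open Literature.MeasureTheory.Integral

variable {E Y K : Type*}
  [NormedAddCommGroup E] [NormedSpace ℝ E] [FiniteDimensional ℝ E] [MeasurableSpace E] [BorelSpace E]
  [NormedAddCommGroup Y] [NormedSpace ℝ Y] [FiniteDimensional ℝ Y] [MeasurableSpace Y] [BorelSpace Y]
  [NormedAddCommGroup K] [NormedSpace ℝ K] [FiniteDimensional ℝ K] [MeasurableSpace K] [BorelSpace K]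

/-- ★★★ **THE PUSH-FORWARD OF A SHARP DENSITY UNDER A `C¹` SUBMERSION HAS A CONTINUOUS DENSITY, LOCALLY, GIVEN NULL FIBRE TRACES OF THE EXEMPTION SET IN A PRESCRIBED
FIBRE COORDINATE.**  `E`, `Y`, `K` finite-dimensional real normed spaces with additive Haar measures `μE`, `μY`, `μK`; `M : E → Y` measurable, `C¹` at `a` with onto
differential; `π : E →L[ℝ] K` onto with `ker DM(a)` and `ker π` complementary (so `x ↦ (M x, π x)` is a local diffeomorphism at `a` and `π` is a coordinate ALONG the fibres
of `M`).  Then there are open `O ∋ a`, `D ∋ M a` such that: for every `Z ⊆ E` whose fibre traces over `D` are `μK`-null in the coordinate `π`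
(`∀ y ∈ D, μK {k | ∃ x, x ∈ O ∧ x ∈ Z ∧ M x = y ∧ π x = k} = 0`) and every `r : E → ℝ` measurable, `≥ 0`, bounded on `O`, vanishing off `O`, continuous at each point of
`O` off `Z`, there is `I : Y → ℝ`, `I ≥ 0`, CONTINUOUS ON `D`, with `(r·μE)(M⁻¹ A) = ∫⁻_A I dμY` for every Borel `A ⊆ D`.  (Mathlib `ImplicitFunctionData` with `rightFun := π`;
`FibreCoordinates.continuousOn_density_of_fibreCoordinates_of_ae`; Haar transport `SubmersionPushforward.exists_haarFactor_lintegral_comp_equiv`.)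
[cite: EvansGariepy1992, §3.4.2 Thm 1 and §3.4.3 Thm 2 (C¹-submersion special case)] -/
theorem exists_continuousOn_density_map_of_submersion_fibreAE (μE : Measure E) [μE.IsAddHaarMeasure] (μY : Measure Y) [μY.IsAddHaarMeasure]
    (μK : Measure K) [μK.IsAddHaarMeasure] {M : E → Y} (hMm : Measurable M) {a : E} (hM : ContDiffAt ℝ 1 M a)
    (hsurj : (fderiv ℝ M a).range = ⊤) (π : E →L[ℝ] K) (hπ : π.range = ⊤) (hcompl : IsCompl (fderiv ℝ M a).ker π.ker) :
    ∃ O : Set E, IsOpen O ∧ a ∈ O ∧ ∃ D : Set Y, IsOpen D ∧ M a ∈ D ∧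
      ∀ Z : Set E, (∀ y ∈ D, μK {k | ∃ x, x ∈ O ∧ x ∈ Z ∧ M x = y ∧ π x = k} = 0) →
      ∀ r : E → ℝ, Measurable r → (∀ x, 0 ≤ r x) → (∀ x ∈ O, x ∉ Z → ContinuousAt r x) → (∃ C, ∀ x ∈ O, r x ≤ C) →
        (∀ x, x ∉ O → r x = 0) →
        ∃ I : Y → ℝ, ContinuousOn I D ∧ (∀ W, 0 ≤ I W) ∧
          ∀ A : Set Y, MeasurableSet A → A ⊆ D →
            (μE.withDensity fun x => ENNReal.ofReal (r x)) (M ⁻¹' A) = ∫⁻ W in A, ENNReal.ofReal (I W) ∂μY := by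
  classical
  haveI : CompleteSpace E := FiniteDimensional.complete ℝ E
  haveI : CompleteSpace Y := FiniteDimensional.complete ℝ Y
  haveI : CompleteSpace K := FiniteDimensional.complete ℝ K
  -- the differential and the implicit-function chart `φ = (M, π)`
  set f' : E →L[ℝ] Y := fderiv ℝ M a with hf'def
  have hf : HasStrictFDerivAt M f' a := hM.hasStrictFDerivAt one_ne_zero
  set 𝒟 : ImplicitFunctionData ℝ E Y K :=
    { leftFun := M, leftDeriv := f', rightFun := π, rightDeriv := π, pt := a,
      hasStrictFDerivAt_leftFun := hf, hasStrictFDerivAt_rightFun := π.hasStrictFDerivAt,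
      range_leftDeriv := hsurj, range_rightDeriv := hπ, isCompl_ker := hcompl } with h𝒟
  set φ := 𝒟.toOpenPartialHomeomorph with hφ
  have hφ1 : ∀ x, (φ x).1 = M x := fun x => rfl
  have hφ2 : ∀ x, (φ x).2 = π x := fun x => rfl
  have ha : a ∈ φ.source := 𝒟.pt_mem_toOpenPartialHomeomorph_source
  have hφa : φ a = (M a, π a) := rfl
  -- `φ.symm` is C¹ at `φ a`
  have hsm : ContDiffAt ℝ 1 φ.symm (φ a) := by
    have hr : ContDiffAt ℝ 1 𝒟.rightFun 𝒟.pt := π.contDiff.contDiffAt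
    have h := ImplicitFunctionData.contDiffAt_implicitFunction (φ := 𝒟) (n := 1) hM hr one_ne_zero
    rw [ImplicitFunctionData.implicitFunction_def, Function.uncurry_curry] at h
    exact h
  -- a neighbourhood of `φ a` inside the target on which `φ.symm` is C¹
  obtain ⟨W', hW'sub, hW'o, haW'⟩ : ∃ W' : Set (Y × K), W' ⊆ {p | ContDiffAt ℝ 1 φ.symm p} ∩ φ.target ∧
      IsOpen W' ∧ φ a ∈ W' := by
    have h1 : ∀ᶠ p in 𝓝 (φ a), ContDiffAt ℝ 1 φ.symm p := hsm.eventually (by simp)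
    have h2 : ∀ᶠ p in 𝓝 (φ a), p ∈ φ.target := φ.open_target.mem_nhds (φ.map_source ha)
    obtain ⟨W', hW', hW'o, hmem⟩ := _root_.eventually_nhds_iff.1 (h1.and h2)
    exact ⟨W', fun p hp => hW' p hp, hW'o, hmem⟩
  have hW't : W' ⊆ φ.target := fun p hp => (hW'sub hp).2
  have hsmOn : ContDiffOn ℝ 1 φ.symm W' := fun p hp => (show ContDiffAt ℝ 1 φ.symm p from (hW'sub hp).1).contDiffWithinAt
  have hdiff : ∀ p ∈ W', HasFDerivAt φ.symm (fderiv ℝ φ.symm p) p := fun p hp =>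
    ((show ContDiffAt ℝ 1 φ.symm p from (hW'sub hp).1).differentiableAt one_ne_zero).hasFDerivAt
  have hcontD : ContinuousOn (fderiv ℝ φ.symm) W' := hsmOn.continuousOn_fderiv_of_isOpen hW'o le_rfl
  -- the linear identification `L = (DM(a), π) : E ≃L Y × K`
  set L : E ≃L[ℝ] Y × K := f'.equivProdOfSurjectiveOfIsCompl π hsurj hπ hcompl with hL
  -- radii: a compact ball inside `W'`, and the product window of half the radius
  obtain ⟨ε, hε, hεW⟩ : ∃ ε > 0, closedBall (φ a) ε ⊆ W' := nhds_basis_closedBall.mem_iff.1 (hW'o.mem_nhds haW')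
  set D : Set Y := ball (M a) (ε / 2) with hD
  set V : Set K := ball (π a) (ε / 2) with hV
  set U : Set (Y × K) := D ×ˢ V with hU
  have hε2 : 0 < ε / 2 := by positivity
  have hUball : U = ball (φ a) (ε / 2) := by rw [hU, hD, hV, hφa, ball_prod_same]
  have hUW : U ⊆ W' := by
    rw [hUball]; exact (ball_subset_closedBall.trans (closedBall_subset_closedBall (by linarith))).trans hεW
  have hUt : U ⊆ φ.target := hUW.trans hW't
  have hUo : IsOpen U := by rw [hUball]; exact isOpen_ball
  have hUm : MeasurableSet U := hUo.measurableSet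
  have haU : φ a ∈ U := by rw [hUball]; exact mem_ball_self hε2
  -- bound for the Jacobian of `L ∘ φ.symm` on the compact ball
  have hJcont : ContinuousOn (fun p => ((L : E →L[ℝ] Y × K).comp (fderiv ℝ φ.symm p)).det) W' :=
    ContinuousLinearMap.continuous_det.comp_continuousOn
      (((ContinuousLinearMap.compL ℝ (Y × K) E (Y × K)) (L : E →L[ℝ] Y × K)).continuous.comp_continuousOn hcontD)
  obtain ⟨CJ, hCJ⟩ : ∃ CJ, ∀ p ∈ closedBall (φ a) ε, ‖((L : E →L[ℝ] Y × K).comp (fderiv ℝ φ.symm p)).det‖ ≤ CJ :=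
    (isCompact_closedBall (φ a) ε).exists_bound_of_continuousOn (hJcont.mono hεW)
  -- the chart neighbourhood `O = φ.symm (U)`
  set O : Set E := φ.symm '' U with hO
  have hOo : IsOpen O := φ.isOpen_image_symm_of_subset_target hUo hUt
  have haO : a ∈ O := ⟨φ a, haU, φ.left_inv ha⟩
  refine ⟨O, hOo, haO, D, isOpen_ball, mem_ball_self hε2, ?_⟩
  intro Z hZ r hrm hr0 hrc hrb hrO
  obtain ⟨Cr, hCr⟩ := hrb
  -- the model objects on `Y × K`
  set Ψ : Y × K → Y × K := U.piecewise (fun p => L (φ.symm p)) (fun _ => L a) with hΨ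
  set Ψ' : Y × K → (Y × K →L[ℝ] Y × K) := fun p => (L : E →L[ℝ] Y × K).comp (fderiv ℝ φ.symm p) with hΨ'
  set M' : Y × K → Y := fun y => M (L.symm y) with hM'
  set r' : Y × K → ℝ := fun y => r (L.symm y) with hr'
  have hΨU : ∀ p ∈ U, Ψ p = L (φ.symm p) := fun p hp => by rw [hΨ, piecewise_eq_of_mem _ _ _ hp]
  -- hypotheses of the fibre-coordinate engine
  have hΨ'w : ∀ p ∈ U, HasFDerivWithinAt Ψ (Ψ' p) U p := by
    intro p hp
    have h : HasFDerivAt (fun q => L (φ.symm q)) (Ψ' p) p :=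
      (L : E →L[ℝ] Y × K).hasFDerivAt.comp p (hdiff p (hUW hp))
    exact h.hasFDerivWithinAt.congr (fun q hq => hΨU q hq) (hΨU p hp)
  have hinj : InjOn Ψ U := by
    intro p hp q hq hpq
    rw [hΨU p hp, hΨU q hq] at hpq
    have h := L.injective hpq
    exact φ.symm.injOn (φ.symm_source.symm ▸ hUt hp) (φ.symm_source.symm ▸ hUt hq) h
  have hΨm : Measurable Ψ := by
    refine ContinuousOn.measurable_piecewise ?_ continuousOn_const hUm
    exact L.continuous.comp_continuousOn (φ.continuousOn_symm.mono hUt)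
  have hJm : Measurable fun p => (Ψ' p).det :=
    ContinuousLinearMap.continuous_det.measurable.comp
      (((ContinuousLinearMap.compL ℝ (Y × K) E (Y × K)) (L : E →L[ℝ] Y × K)).continuous.measurable.comp
        (measurable_fderiv ℝ φ.symm))
  have hM'm : Measurable M' := hMm.comp L.symm.continuous.measurable
  have hM'Ψ : ∀ p ∈ U, M' (Ψ p) = p.1 := by
    intro p hp
    rw [hΨU p hp, hM']
    show M (L.symm (L (φ.symm p))) = p.1
    rw [L.symm_apply_apply, ← hφ1, φ.right_inv (hUt hp)]
  have hr'm : Measurable r' := hrm.comp L.symm.continuous.measurable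
  have hr'0 : ∀ y, 0 ≤ r' y := fun y => hr0 _
  have hsupp : ∀ y, M' y ∈ D → y ∉ Ψ '' U → r' y = 0 := by
    intro y _ hy
    apply hrO
    rintro ⟨p, hp, hpy⟩
    exact hy ⟨p, hp, by rw [hΨU p hp, hpy, L.apply_symm_apply]⟩
  have hr'Ψ : ∀ p ∈ U, r' (Ψ p) = r (φ.symm p) := by
    intro p hp
    show r (L.symm (Ψ p)) = r (φ.symm p)
    rw [hΨU p hp, L.symm_apply_apply]
  have hCI : ∀ p ∈ D ×ˢ V, |(Ψ' p).det| * r' (Ψ p) ≤ max CJ 0 * max Cr 0 := by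
    intro p hp
    rw [← hU] at hp
    have h1 : |(Ψ' p).det| ≤ max CJ 0 :=
      (le_trans (by simpa [Real.norm_eq_abs] using hCJ p ((ball_subset_closedBall.trans
        (closedBall_subset_closedBall (by linarith))) (hUball ▸ hp))) (le_max_left _ _))
    have h2 : r' (Ψ p) ≤ max Cr 0 := by
      rw [hr'Ψ p hp]
      exact (hCr _ ⟨p, hp, rfl⟩).trans (le_max_left _ _)
    exact mul_le_mul h1 h2 (hr'0 _) (le_max_of_le_right le_rfl)
  have hVm : MeasurableSet V := isOpen_ball.measurableSet
  have hDm : MeasurableSet D := isOpen_ball.measurableSet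
  have hVfin : μK V ≠ ∞ := (measure_ball_lt_top).ne
  -- the a.e. continuity of the fibre integrand: off the null fibre trace of `Z`
  have hcontAE : ∀ W₀ ∈ D, ∀ᵐ B ∂(μK.restrict V),
      ContinuousWithinAt (fun W => |(Ψ' (W, B)).det| * r' (Ψ (W, B))) D W₀ := by
    intro W₀ hW₀
    refine FibreCoordinates.ae_continuousWithinAt_of_null_fibreSet μK hVm (G := fun p => |(Ψ' p).det| * r' (Ψ p))
      (D := D) (Z := {p : Y × K | p ∈ U ∧ φ.symm p ∈ Z}) (W₀ := W₀) ?_ ?_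
    · -- the fibre trace over `W₀` lies in the prescribed null set
      refine measure_mono_null (fun B hB => ?_) (hZ W₀ hW₀)
      obtain ⟨_, hBU, hBZ⟩ := hB
      refine ⟨φ.symm (W₀, B), ⟨(W₀, B), hBU, rfl⟩, hBZ, ?_, ?_⟩
      · rw [← hφ1, φ.right_inv (hUt hBU)]
      · rw [← hφ2, φ.right_inv (hUt hBU)]
    · intro B hB hBZ
      have hp : (W₀, B) ∈ U := by rw [hU]; exact ⟨hW₀, hB⟩
      have hnotZ : φ.symm (W₀, B) ∉ Z := fun h => hBZ ⟨hp, h⟩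
      have hxO : φ.symm (W₀, B) ∈ O := ⟨(W₀, B), hp, rfl⟩
      -- continuity of the Jacobian factor in `W`
      have hmk : ContinuousWithinAt (fun W : Y => (W, B)) D W₀ :=
        ((continuous_id.prodMk continuous_const : Continuous fun W : Y => (W, B))).continuousWithinAt
      have hmaps : MapsTo (fun W : Y => (W, B)) D U := fun W hW => by rw [hU]; exact ⟨hW, hB⟩
      have hJ : ContinuousWithinAt (fun W => |(Ψ' (W, B)).det|) D W₀ := by
        have h2 : ContinuousWithinAt (fun p => (Ψ' p).det) U (W₀, B) := (hJcont.mono hUW) _ hp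
        have h3 : ContinuousWithinAt (fun W => (Ψ' (W, B)).det) D W₀ :=
          ContinuousWithinAt.comp (f := fun W : Y => (W, B)) (x := W₀) h2 hmk hmaps
        exact continuous_abs.continuousAt.comp_continuousWithinAt h3
      -- continuity of the density factor in `W`: `r` is continuous at the fibre point, `φ.symm` is continuous
      have hR : ContinuousWithinAt (fun W => r' (Ψ (W, B))) D W₀ := by
        have hsymm : ContinuousWithinAt (fun W : Y => φ.symm (W, B)) D W₀ :=
          ContinuousWithinAt.comp (f := fun W : Y => (W, B)) (x := W₀) ((φ.continuousOn_symm.mono hUt) _ hp) hmk hmaps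
        have h : ContinuousWithinAt (fun W : Y => r (φ.symm (W, B))) D W₀ :=
          ContinuousAt.comp_continuousWithinAt (f := fun W : Y => φ.symm (W, B)) (hrc _ hxO hnotZ) hsymm
        refine h.congr (fun W hW => hr'Ψ (W, B) (by rw [hU]; exact ⟨hW, hB⟩)) (hr'Ψ (W₀, B) hp)
      exact hJ.mul hR
  -- the fibre-coordinate engine (a.e. form) in the model `Y × K`
  obtain ⟨hIcont, hIdens⟩ := FibreCoordinates.continuousOn_density_of_fibreCoordinates_of_ae μY μK hDm hVm hVfin hU
    hΨ'w hinj hΨm hJm hM'm hM'Ψ hr'm hr'0 hsupp hcontAE hCI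
  -- transport back to `E` along `L`
  obtain ⟨c, hc, hcid⟩ := SubmersionPushforward.exists_haarFactor_lintegral_comp_equiv μE μY μK L
  set I₀ : Y → ℝ := fun W => ∫ B in V, |(Ψ' (W, B)).det| * r' (Ψ (W, B)) ∂μK with hI₀
  have hI₀0 : ∀ W, 0 ≤ I₀ W := fun W => setIntegral_nonneg hVm fun B _ => mul_nonneg (abs_nonneg _) (hr'0 _)
  refine ⟨fun W => (c : ℝ) * I₀ W, (continuousOn_const.mul hIcont), fun W => mul_nonneg c.coe_nonneg (hI₀0 W), ?_⟩
  intro A hA hAD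
  have hpre : M ⁻¹' A = L ⁻¹' (M' ⁻¹' A) := by
    ext x
    simp only [mem_preimage, hM', L.symm_apply_apply]
  calc (μE.withDensity fun x => ENNReal.ofReal (r x)) (M ⁻¹' A)
      = ∫⁻ x, (M ⁻¹' A).indicator (fun x => ENNReal.ofReal (r x)) x ∂μE := by
        rw [withDensity_apply _ (hMm hA), lintegral_indicator (hMm hA)]
    _ = ∫⁻ x, (M' ⁻¹' A).indicator (fun y => ENNReal.ofReal (r' y)) (L x) ∂μE := by
        refine lintegral_congr (fun x => ?_)
        rw [hpre]
        simp only [indicator, mem_preimage, hr', L.symm_apply_apply]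
    _ = c * ∫⁻ y, (M' ⁻¹' A).indicator (fun y => ENNReal.ofReal (r' y)) y ∂(μY.prod μK) :=
        hcid _ (((ENNReal.measurable_ofReal.comp hr'm)).indicator (hM'm hA))
    _ = c * ((μY.prod μK).withDensity fun y => ENNReal.ofReal (r' y)) (M' ⁻¹' A) := by
        rw [withDensity_apply _ (hM'm hA), lintegral_indicator (hM'm hA)]
    _ = c * ∫⁻ W in A, ENNReal.ofReal (I₀ W) ∂μY := by rw [hIdens A hA hAD]
    _ = ∫⁻ W in A, ENNReal.ofReal ((c : ℝ) * I₀ W) ∂μY := by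
        rw [← lintegral_const_mul' _ _ ENNReal.coe_ne_top]
        refine lintegral_congr (fun W => ?_)
        rw [ENNReal.ofReal_mul c.coe_nonneg, ENNReal.ofReal_coe_nnreal]

/-- ★ **PREDICATE SPELLING** (the shape of the local-face doors): with an exemption predicate `Q` on `E` whose failure set has `μK`-null fibre traces over the coarse window in
the coordinate `π`, every measurable bounded `r ≥ 0` vanishing off `O` and continuous at each `x ∈ O` with `Q x` has a push-forward density continuous on `D`.
[cite: EvansGariepy1992, §3.4.3 Thm 2 (C¹-submersion special case)] -/
theorem exists_continuousOn_density_map_of_submersion_fibreAE' (μE : Measure E) [μE.IsAddHaarMeasure] (μY : Measure Y) [μY.IsAddHaarMeasure]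
    (μK : Measure K) [μK.IsAddHaarMeasure] {M : E → Y} (hMm : Measurable M) {a : E} (hM : ContDiffAt ℝ 1 M a)
    (hsurj : (fderiv ℝ M a).range = ⊤) (π : E →L[ℝ] K) (hπ : π.range = ⊤) (hcompl : IsCompl (fderiv ℝ M a).ker π.ker) :
    ∃ O : Set E, IsOpen O ∧ a ∈ O ∧ ∃ D : Set Y, IsOpen D ∧ M a ∈ D ∧
      ∀ Q : E → Prop, (∀ y ∈ D, μK {k | ∃ x, x ∈ O ∧ ¬ Q x ∧ M x = y ∧ π x = k} = 0) →
      ∀ r : E → ℝ, Measurable r → (∀ x, 0 ≤ r x) → (∀ x ∈ O, Q x → ContinuousAt r x) → (∃ C, ∀ x ∈ O, r x ≤ C) →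
        (∀ x, x ∉ O → r x = 0) →
        ∃ I : Y → ℝ, ContinuousOn I D ∧ (∀ W, 0 ≤ I W) ∧
          ∀ A : Set Y, MeasurableSet A → A ⊆ D →
            (μE.withDensity fun x => ENNReal.ofReal (r x)) (M ⁻¹' A) = ∫⁻ W in A, ENNReal.ofReal (I W) ∂μY := by
  obtain ⟨O, hO, haO, D, hD, haD, h⟩ :=
    exists_continuousOn_density_map_of_submersion_fibreAE μE μY μK hMm hM hsurj π hπ hcompl
  refine ⟨O, hO, haO, D, hD, haD, fun Q hQ r hrm hr0 hrc hrb hrO => ?_⟩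
  refine h {x | ¬ Q x} (fun y hy => by simpa using hQ y hy) r hrm hr0 (fun x hx hxQ => hrc x hx ?_) hrb hrO
  simpa using hxQ

end Summit.QuantumFields.YangMills.Theorems.FluctuationComparisonRegPrIntLS1aSubmersionDensityFibreAE

end
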